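import Mathlib
import HarnessLib
import Literature.MathematicalPhysics.KineticTheory.HardSphereEuler
import Literature.MathematicalPhysics.KineticTheory.BackwardCluster
import Literature.MathematicalPhysics.KineticTheory.HardSphereDisplacementPathLength

/-!
# The speed-threshold budget for collision chains (crux `RelayRaceLocality.GibbsLightCone`,
stmt-AtomisticToContinuum-12501, line `Sketch`, skeleton revision 6)

Helper file (`--supports stmt-AtomisticToContinuum-12501`). The earlier revisions of the line reduced
the crux, sorry-free, to ONE kinetic-scale tail in chain currency: path length plus contact offsets
of some collision chain into the tagged particle over a window of `M ≤ K log(N+2)` mean-free-time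
units exceeds `λ M ℓ_N` with probability `≤ C e^{-cM}` (`RelayRaceLocalityGibbsLightConeChainBridge`).
Revision 6 applies the deterministic SPEED-THRESHOLD BUDGET (idea card `cold-budget-hot-needles`):
pointwise `‖v‖ ≤ K + ‖v‖·1{K < ‖v‖}` (`K = A√θ ≥ 0`), so on a good orbit the path length of a
carrier over a carrying interval is at most `A√θ·Δt` plus its HOT path length
(`integral_norm_vel_le_threshold_add_hot`; the speed along a good orbit is measurable in time and
bounded, `HardSphereFlow.intervalIntegrable_norm_vel_flow`). Summed over the carrying intervals of a
chain spanning `[0, M τ_N]`, `τ_N = ℓ_N/√θ`, the thermal part telescopes to `A√θ·M τ_N = A·M ℓ_N` and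
is absorbed into `λ`: the THERMAL SECTOR LEAVES THE OBLIGATION. The chain path-length tail over
SIMPLE chains (injective label sequences, supplied by `stub_simpleChainOfMember`) then follows by a
union bound from two sector tails (`simpleChainPathLengthTail_of_hot_of_links`): the HOT path-length
tail (`stub_hotPathLengthTail`: hot path length of some simple chain `> λ_h M ℓ_N`) and the LINK-COUNT
tail (`stub_linkCountTail`: some simple chain has `k ε_N > λ_l M ℓ_N`, i.e. more than `λ_l M/σ³`
links). Neither sector tail is proved here or in print at fixed reduced density; both need a
cross-time ("seam") input for the deterministic equilibrium flow. The composition with the crux is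
`RelayRaceLocalityGibbsLightConeSimpleChainBridge.lean`.
-/

namespace Summit.AtomisticToContinuum.HydrodynamicLimit.Theorems.LogWindowTaggedTail

open Literature.MathematicalPhysics.KineticTheory Literature.Analysis.FluidPDE MeasureTheory Filter Set

open scoped ENNReal

/-- SPEED-THRESHOLD BUDGET, one carrying interval (deterministic): on a good orbit, the path length of
particle `i` over `[t₁, t₂]` is at most `K (t₂ - t₁)` plus its HOT path length (speed above `K ≥ 0`
only). Pointwise `‖v‖ ≤ K + ‖v‖·1{K < ‖v‖}`, integrated (the speed along a good orbit is measurable in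
time and bounded, `HardSphereFlow.intervalIntegrable_norm_vel_flow`). [folklore] -/
theorem integral_norm_vel_le_threshold_add_hot {N : ℕ} {ε : ℝ}
    (Φ : HardSphereFlow (Torus.geometry (Fin 3)) ε N) {z : Config N (Fin 3) T3} (hz : z ∈ Φ.good)
    (i : Fin N) {K t₁ t₂ : ℝ} (hK : 0 ≤ K) (h12 : t₁ ≤ t₂) :
    ∫ u in t₁..t₂, ‖(Φ.flow u z i).2‖ ≤
      K * (t₂ - t₁) + ∫ u in t₁..t₂, (if K < ‖(Φ.flow u z i).2‖ then ‖(Φ.flow u z i).2‖ else 0) := by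
  set f : ℝ → ℝ := fun u => ‖(Φ.flow u z i).2‖ with hf
  set g : ℝ → ℝ := fun u => if K < ‖(Φ.flow u z i).2‖ then ‖(Φ.flow u z i).2‖ else 0 with hg
  have hfi : IntervalIntegrable f volume t₁ t₂ := Φ.intervalIntegrable_norm_vel_flow hz i t₁ t₂
  have hfm : Measurable f := Φ.measurable_norm_vel_orbit hz i
  have hg_eq : g = Set.indicator {u | K < f u} f := by
    funext u
    simp only [hg, hf, Set.indicator_apply, Set.mem_setOf_eq]
  have hgm : Measurable g := by
    rw [hg_eq]
    exact hfm.indicator (measurableSet_lt measurable_const hfm)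
  have hgi : IntervalIntegrable g volume t₁ t₂ := by
    refine hfi.mono_fun' hgm.aestronglyMeasurable (ae_of_all _ fun u => ?_)
    simp only [hg, hf]
    split_ifs with h
    · simp
    · simp
  have hpt : ∀ u ∈ Set.Icc t₁ t₂, f u ≤ (fun u => K + g u) u := by
    intro u _
    simp only [hg, hf]
    split_ifs with h
    · linarith
    · linarith
  have hmono := intervalIntegral.integral_mono_on h12 hfi (intervalIntegrable_const.add hgi) hpt
  rw [intervalIntegral.integral_add intervalIntegrable_const hgi, intervalIntegral.integral_const,
    smul_eq_mul] at hmono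
  simpa [hf, hg, mul_comm] using hmono

/-- THE SIMPLE-CHAIN PATH-LENGTH TAIL FROM THE TWO SECTORS (proved glue: speed-threshold budget +
union bound). With the hot tail at threshold `A√θ` and constants `(λ_h, c_h, C_h)` and the link-count
tail with `(λ_l, c_l, C_l)`: the event "path length + `k ε` of some simple chain `> (A + λ_h + λ_l) M ℓ_N`"
is contained (on the good set) in the union of the two sector events, since the path length is at most
`A√θ · M τ_N + H = A M ℓ_N + H` (`integral_norm_vel_le_threshold_add_hot`, telescoping over the
carrying intervals). [folklore] -/
theorem simpleChainPathLengthTail_of_hot_of_links :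
    (∀ a θ : ℝ, 0 < a → 0 < θ → ∃ σ₀ : ℝ, 0 < σ₀ ∧ ∃ A lam c C : ℝ, 0 ≤ A ∧ 0 < c ∧
      ∀ K : ℝ, 0 < K → ∀ σ : ℝ, 0 < σ → σ < σ₀ →
      ∀ Φ : (N : ℕ) → HardSphereFlow (Torus.geometry (Fin 3)) (hsDiameter σ N) (N + 1),
      ∀ᶠ N in atTop, ∀ p : Fin (N + 1), ∀ M : ℝ, 1 ≤ M → M ≤ K * Real.log ((N : ℝ) + 2) →
        localGibbsLaw σ (fun _ => a) (fun _ => 0) (fun _ => θ) N (Φ N)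
          {z | ∃ (k : ℕ) (q : Fin (k + 1) → Fin (N + 1)) (T : Fin (k + 2) → ℝ),
              q (Fin.last k) = p ∧ Function.Injective q ∧ Monotone T ∧
              StrictMono (fun m : Fin k => T (Fin.castSucc (Fin.succ m))) ∧ T 0 = 0 ∧
              T (Fin.last (k + 1)) = M * (((N + 1 : ℕ) : ℝ) ^ (-(1 / 3 : ℝ)) / σ ^ 2 / Real.sqrt θ) ∧
              (∀ m : Fin k, s(q (Fin.castSucc m), q (Fin.succ m)) ∈
                contactPairSet (Torus.geometry (Fin 3)) (hsDiameter σ N)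
                  ((Φ N).flow (T (Fin.castSucc (Fin.succ m))) z)) ∧
              lam * M * (((N + 1 : ℕ) : ℝ) ^ (-(1 / 3 : ℝ)) / σ ^ 2) <
                ∑ m : Fin (k + 1), ∫ u in T (Fin.castSucc m)..T (Fin.succ m),
                  (if A * Real.sqrt θ < ‖(((Φ N).flow u z) (q m)).2‖ then
                    ‖(((Φ N).flow u z) (q m)).2‖ else 0)}
          ≤ ENNReal.ofReal (C * Real.exp (-c * M))) →
    (∀ a θ : ℝ, 0 < a → 0 < θ → ∃ σ₀ : ℝ, 0 < σ₀ ∧ ∃ lam c C : ℝ, 0 < c ∧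
      ∀ K : ℝ, 0 < K → ∀ σ : ℝ, 0 < σ → σ < σ₀ →
      ∀ Φ : (N : ℕ) → HardSphereFlow (Torus.geometry (Fin 3)) (hsDiameter σ N) (N + 1),
      ∀ᶠ N in atTop, ∀ p : Fin (N + 1), ∀ M : ℝ, 1 ≤ M → M ≤ K * Real.log ((N : ℝ) + 2) →
        localGibbsLaw σ (fun _ => a) (fun _ => 0) (fun _ => θ) N (Φ N)
          {z | ∃ (k : ℕ) (q : Fin (k + 1) → Fin (N + 1)) (T : Fin (k + 2) → ℝ),
              q (Fin.last k) = p ∧ Function.Injective q ∧ Monotone T ∧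
              StrictMono (fun m : Fin k => T (Fin.castSucc (Fin.succ m))) ∧ T 0 = 0 ∧
              T (Fin.last (k + 1)) = M * (((N + 1 : ℕ) : ℝ) ^ (-(1 / 3 : ℝ)) / σ ^ 2 / Real.sqrt θ) ∧
              (∀ m : Fin k, s(q (Fin.castSucc m), q (Fin.succ m)) ∈
                contactPairSet (Torus.geometry (Fin 3)) (hsDiameter σ N)
                  ((Φ N).flow (T (Fin.castSucc (Fin.succ m))) z)) ∧
              lam * M * (((N + 1 : ℕ) : ℝ) ^ (-(1 / 3 : ℝ)) / σ ^ 2) < k * hsDiameter σ N}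
          ≤ ENNReal.ofReal (C * Real.exp (-c * M))) →
    ∀ a θ : ℝ, 0 < a → 0 < θ → ∃ σ₀ : ℝ, 0 < σ₀ ∧ ∃ lam c C : ℝ, 0 < c ∧ ∀ K : ℝ, 0 < K →
      ∀ σ : ℝ, 0 < σ → σ < σ₀ →
      ∀ Φ : (N : ℕ) → HardSphereFlow (Torus.geometry (Fin 3)) (hsDiameter σ N) (N + 1),
      ∀ᶠ N in atTop, ∀ p : Fin (N + 1), ∀ M : ℝ, 1 ≤ M → M ≤ K * Real.log ((N : ℝ) + 2) →
        localGibbsLaw σ (fun _ => a) (fun _ => 0) (fun _ => θ) N (Φ N)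
          {z | ∃ (k : ℕ) (q : Fin (k + 1) → Fin (N + 1)) (T : Fin (k + 2) → ℝ),
              q (Fin.last k) = p ∧ Function.Injective q ∧ Monotone T ∧
              StrictMono (fun m : Fin k => T (Fin.castSucc (Fin.succ m))) ∧ T 0 = 0 ∧
              T (Fin.last (k + 1)) = M * (((N + 1 : ℕ) : ℝ) ^ (-(1 / 3 : ℝ)) / σ ^ 2 / Real.sqrt θ) ∧
              (∀ m : Fin k, s(q (Fin.castSucc m), q (Fin.succ m)) ∈
                contactPairSet (Torus.geometry (Fin 3)) (hsDiameter σ N)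
                  ((Φ N).flow (T (Fin.castSucc (Fin.succ m))) z)) ∧
              lam * M * (((N + 1 : ℕ) : ℝ) ^ (-(1 / 3 : ℝ)) / σ ^ 2) <
                (∑ m : Fin (k + 1), ∫ u in T (Fin.castSucc m)..T (Fin.succ m),
                    ‖(((Φ N).flow u z) (q m)).2‖) + k * hsDiameter σ N}
          ≤ ENNReal.ofReal (C * Real.exp (-c * M)) := by
  intro hHot hLinks a θ ha hθ
  obtain ⟨σ₁, hσ₁, A, lamH, cH, CH, hA, hcH, H1⟩ := hHot a θ ha hθ
  obtain ⟨σ₂, hσ₂, lamL, cL, CL, hcL, H2⟩ := hLinks a θ ha hθ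
  refine ⟨min σ₁ σ₂, lt_min hσ₁ hσ₂, A + lamH + lamL, min cH cL, |CH| + |CL|, lt_min hcH hcL, ?_⟩
  intro K hK σ hσ hσlt Φ
  filter_upwards [H1 K hK σ hσ (lt_of_lt_of_le hσlt (min_le_left _ _)) Φ,
    H2 K hK σ hσ (lt_of_lt_of_le hσlt (min_le_right _ _)) Φ] with N hN1 hN2 p M hM hMK
  -- abbreviations
  set ℓ : ℝ := ((N + 1 : ℕ) : ℝ) ^ (-(1 / 3 : ℝ)) / σ ^ 2 with hℓ
  set W : ℝ := M * (((N + 1 : ℕ) : ℝ) ^ (-(1 / 3 : ℝ)) / σ ^ 2 / Real.sqrt θ) with hW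
  set P := localGibbsLaw σ (fun _ => a) (fun _ => 0) (fun _ => θ) N (Φ N) with hP
  have hsqrt : 0 < Real.sqrt θ := Real.sqrt_pos.2 hθ
  have hKW : A * Real.sqrt θ * W = A * M * ℓ := by
    rw [hW, hℓ]
    field_simp
  have hM0 : 0 ≤ M := by linarith
  -- the two sector events
  set EH : Set (Config (N + 1) (Fin 3) T3) :=
    {z | ∃ (k : ℕ) (q : Fin (k + 1) → Fin (N + 1)) (T : Fin (k + 2) → ℝ),
        q (Fin.last k) = p ∧ Function.Injective q ∧ Monotone T ∧
        StrictMono (fun m : Fin k => T (Fin.castSucc (Fin.succ m))) ∧ T 0 = 0 ∧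
        T (Fin.last (k + 1)) = W ∧
        (∀ m : Fin k, s(q (Fin.castSucc m), q (Fin.succ m)) ∈
          contactPairSet (Torus.geometry (Fin 3)) (hsDiameter σ N)
            ((Φ N).flow (T (Fin.castSucc (Fin.succ m))) z)) ∧
        lamH * M * ℓ <
          ∑ m : Fin (k + 1), ∫ u in T (Fin.castSucc m)..T (Fin.succ m),
            (if A * Real.sqrt θ < ‖(((Φ N).flow u z) (q m)).2‖ then
              ‖(((Φ N).flow u z) (q m)).2‖ else 0)} with hEH
  set EL : Set (Config (N + 1) (Fin 3) T3) :=
    {z | ∃ (k : ℕ) (q : Fin (k + 1) → Fin (N + 1)) (T : Fin (k + 2) → ℝ),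
        q (Fin.last k) = p ∧ Function.Injective q ∧ Monotone T ∧
        StrictMono (fun m : Fin k => T (Fin.castSucc (Fin.succ m))) ∧ T 0 = 0 ∧
        T (Fin.last (k + 1)) = W ∧
        (∀ m : Fin k, s(q (Fin.castSucc m), q (Fin.succ m)) ∈
          contactPairSet (Torus.geometry (Fin 3)) (hsDiameter σ N)
            ((Φ N).flow (T (Fin.castSucc (Fin.succ m))) z)) ∧
        lamL * M * ℓ < k * hsDiameter σ N} with hEL
  have h1 : P EH ≤ ENNReal.ofReal (CH * Real.exp (-cH * M)) := hN1 p M hM hMK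
  have h2 : P EL ≤ ENNReal.ofReal (CL * Real.exp (-cL * M)) := hN2 p M hM hMK
  -- the Gibbs law does not charge the bad set
  have hnull : P (Φ N).goodᶜ = 0 := by
    rw [hP, localGibbsLaw, particleLaw_eq]
    exact withDensity_absolutelyContinuous _ _ (Φ N).measure_compl_good
  rw [← measure_inter_conull hnull]
  -- the budget: on the good set the event lies in the union of the two sector events
  have hsub : {z | ∃ (k : ℕ) (q : Fin (k + 1) → Fin (N + 1)) (T : Fin (k + 2) → ℝ),
        q (Fin.last k) = p ∧ Function.Injective q ∧ Monotone T ∧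
        StrictMono (fun m : Fin k => T (Fin.castSucc (Fin.succ m))) ∧ T 0 = 0 ∧
        T (Fin.last (k + 1)) = W ∧
        (∀ m : Fin k, s(q (Fin.castSucc m), q (Fin.succ m)) ∈
          contactPairSet (Torus.geometry (Fin 3)) (hsDiameter σ N)
            ((Φ N).flow (T (Fin.castSucc (Fin.succ m))) z)) ∧
        (A + lamH + lamL) * M * ℓ <
          (∑ m : Fin (k + 1), ∫ u in T (Fin.castSucc m)..T (Fin.succ m),
              ‖(((Φ N).flow u z) (q m)).2‖) + k * hsDiameter σ N} ∩ (Φ N).good ⊆ EH ∪ EL := by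
    rintro z ⟨⟨k, q, T, hqk, hinj, hmono, hstrict, hT0, hTlast, hlink, hdist⟩, hz⟩
    have hz' : z ∈ (Φ N).good := hz
    -- hot path length of the chain
    set Hhot : ℝ := ∑ m : Fin (k + 1), ∫ u in T (Fin.castSucc m)..T (Fin.succ m),
        (if A * Real.sqrt θ < ‖(((Φ N).flow u z) (q m)).2‖ then
          ‖(((Φ N).flow u z) (q m)).2‖ else 0) with hHhot
    -- budget, interval by interval
    have hKnn : 0 ≤ A * Real.sqrt θ := mul_nonneg hA hsqrt.le
    have hterm : ∀ m : Fin (k + 1),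
        ∫ u in T (Fin.castSucc m)..T (Fin.succ m), ‖(((Φ N).flow u z) (q m)).2‖ ≤
          A * Real.sqrt θ * (T (Fin.succ m) - T (Fin.castSucc m)) +
            ∫ u in T (Fin.castSucc m)..T (Fin.succ m),
              (if A * Real.sqrt θ < ‖(((Φ N).flow u z) (q m)).2‖ then
                ‖(((Φ N).flow u z) (q m)).2‖ else 0) :=
      fun m => integral_norm_vel_le_threshold_add_hot (Φ N) hz' (q m) hKnn
        (hmono (Fin.castSucc_lt_succ).le)
    have hsum := Finset.sum_le_sum fun m (_ : m ∈ Finset.univ) => hterm m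
    rw [Finset.sum_add_distrib, ← Finset.mul_sum] at hsum
    -- telescoping of the carrying intervals
    have htel : ∑ m : Fin (k + 1), (T (Fin.succ m) - T (Fin.castSucc m)) =
        T (Fin.last (k + 1)) - T 0 := by
      rw [Finset.sum_sub_distrib]
      have hs := Fin.sum_univ_succ T
      have hc := Fin.sum_univ_castSucc T
      linarith
    rw [htel, hTlast, hT0, sub_zero, hKW] at hsum
    -- split
    by_cases hhot : lamH * M * ℓ < Hhot
    · exact Or.inl ⟨k, q, T, hqk, hinj, hmono, hstrict, hT0, hTlast, hlink, hhot⟩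
    · refine Or.inr ⟨k, q, T, hqk, hinj, hmono, hstrict, hT0, hTlast, hlink, ?_⟩
      have hhot' := not_lt.1 hhot
      have hd : (A + lamH + lamL) * M * ℓ = A * M * ℓ + lamH * M * ℓ + lamL * M * ℓ := by ring
      rw [hd] at hdist
      linarith
  refine le_trans (measure_mono hsub) (le_trans (measure_union_le _ _) ?_)
  refine le_trans (add_le_add h1 h2) ?_
  -- `C_h e^{-c_h M} + C_l e^{-c_l M} ≤ (|C_h| + |C_l|) e^{-min(c_h,c_l) M}`
  have hexp : ∀ c' : ℝ, min cH cL ≤ c' → Real.exp (-c' * M) ≤ Real.exp (-(min cH cL) * M) := by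
    intro c' hc'
    exact Real.exp_le_exp.2 (by nlinarith)
  have hle : ∀ C' c' : ℝ, min cH cL ≤ c' →
      C' * Real.exp (-c' * M) ≤ |C'| * Real.exp (-(min cH cL) * M) := by
    intro C' c' hc'
    calc C' * Real.exp (-c' * M) ≤ |C'| * Real.exp (-c' * M) :=
          mul_le_mul_of_nonneg_right (le_abs_self _) (Real.exp_pos _).le
      _ ≤ |C'| * Real.exp (-(min cH cL) * M) :=
          mul_le_mul_of_nonneg_left (hexp c' hc') (abs_nonneg _)
  have hnn : ∀ C' : ℝ, 0 ≤ |C'| * Real.exp (-(min cH cL) * M) :=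
    fun C' => mul_nonneg (abs_nonneg _) (Real.exp_pos _).le
  rw [add_mul, ENNReal.ofReal_add (hnn CH) (hnn CL)]
  exact add_le_add (ENNReal.ofReal_le_ofReal (hle CH cH (min_le_left _ _)))
    (ENNReal.ofReal_le_ofReal (hle CL cL (min_le_right _ _)))

end Summit.AtomisticToContinuum.HydrodynamicLimit.Theorems.LogWindowTaggedTail
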